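import Literature.AlgebraicGeometry.RelativeSpec.SchemeEquivariantModuleInvariants
import Literature.AlgebraicGeometry.RelativeSpec.EquivariantModuleRankDescent
import Literature.AlgebraicGeometry.Modules.IsoOfAffineCover
import Literature.AlgebraicGeometry.Modules.CechBaseChangeHom
import HarnessLib

/-!
# Descent of a linearised quasi-coherent module along a torsor quotient `π : X → Q = X⧸G`, GLOBAL HALF:
# the comparison `π^*(π_*E)^G ⟶ E` is an isomorphism once it is one on the charts `π⁻¹V`; it carries the canonical linearisation to `Φ`;
# the descended module has the rank of `E` ([MumfordAV1970] §12 Thm. 1 (B) (p. 112); [SGA1] Exp. VIII Thm. 1.1, Prop. 1.10)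

Layer `Literature/AlgebraicGeometry/RelativeSpec`, namespace `Literature.AlgebraicGeometry.RelativeSpec.SchemeEquivariant` (= ★ `SchemeEquivariantModuleInvariants`'s).
THEOREMS ONLY (no definition, no named fact, no instance, no notation, no `sorry`).

THE PRINT.  [MumfordAV1970] §12 Thm. 1 (B) (p. 112): for the quotient `π : X → Y` of `X` by a free action of a finite group scheme `G`, `F ↦ π^*F` is an equivalence
between quasi-coherent modules on `Y` and `G`-linearised quasi-coherent modules on `X`, with inverse «the invariant sections of `π_*`»; and a locally free `E` of rank
`r` descends to a locally free module of rank `r` ([SGA1] VIII Prop. 1.10).  The PROOF is chartwise: over an affine `V ⊆ Y` the comparison `π^*(π_*E)^G → E` is the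
faithfully flat descent isomorphism `C ⊗_{C₀} N ≅ M` — and then GLOBAL by gluing.  This file is the GLOBAL HALF, for the coinvariant subsheaf `(π_*E)^G :=
moduleCoinvariants π E hw Φ` of ★ `RelativeSpec/SchemeEquivariantModuleInvariants` (any `[GrpObj G] [ModObj G X]` in `Over S`, `π : X ⟶ Q` with `γ ≫ π = pr₂ ≫ π`, a
linearisation isomorphism `Φ : γ^*E ≅ pr₂^*E`), with the CHART STATEMENT carried as the hypothesis
`hbij : ∀ V affine, Function.Bijective ((descentHom π E hw Φ).app (π⁻¹V))` (discharged, for `π` affine faithfully flat with torsor square and `Φ` a cocycle, by the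
chart organ through ★ `RingTheory/Flat/FaithfullyFlatModuleDescent.liftBaseChange_bijective`):

* §0 `mem_range_moduleCoinvariantsι_app_iff_inf` — the coinvariance condition read in the INTERSECTION chart `γ⁻¹π⁻¹V ⊓ pr₂⁻¹π⁻¹V` (the kernel-pair chart of ★
  `Morphisms/SectionsFpqcDescentChart`, the currency of the chart organ);
* §1 **`isIso_descentHom_of_app_bijective`** — `π^*(π_*E)^G ⟶ E` is an ISOMORPHISM (★ `Modules/IsoOfAffineCover` on the cover `{π⁻¹V}`; both sides quasi-coherent);
* §2 **`pullback_map_descentHom_comp`** — the comparison CARRIES THE CANONICAL LINEARISATION `γ^*π^*P ≅ (γ ≫ π)^*P = (pr₂ ≫ π)^*P ≅ pr₂^*π^*P` TO `Φ` (hypothesis-free;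
  tested on the sections `η_γ(η_π(x))`, where both sides are the coinvariant section `ι(x)` — the twin of ★ `ActionOver.pullback_map_descentHom_comp`);
* §3 **`hasRank_moduleCoinvariants_of_projective_sections`** — if `E` has rank `r`, `π` is surjective and the sections `Γ(V, (π_*E)^G)` over affine `V` are finite
  projective `Γ(V, 𝒪_Q)`-modules (chartwise faithfully flat descent of finite projectivity), then `(π_*E)^G` has rank `r` (★ twin's frame road:
  ★ `exists_free_over_basicOpen_of_projective_sections`, ★ `card_eq_of_free_iso_over_of_hasRank_pullback`, ★ `FrameSystem.hasRank`);
* §4 the ∃-HEADS the §D junction binds: **`exists_descent_of_app_bijective`** (`∃ P qcoh, π^*P ≅ E` compatibly with `Φ`) and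
  **`exists_descent_of_hasRank`** (`∃ P, HasRank P r ∧ Nonempty (π^*P ≅ E)`).

Cell hodgecm-mathlib (D-0151 ∕ D-0183 FLOOR 0), P6b wave C of §D `stub_L4B1uD_mumfordLambdaDescent`, organ (iii) Dγ-ISO (prover «LH5» LH5-p02 (g14); (i) = ★
`SchemeEquivariantModuleInvariants`, LH5-p04 (g14); the chart organ (ii) = LA2-p02 ∕ F0P3a-p06; consumer Dδ = F0P3a-p09).  Generic, count-neutral capital on
`--supports stmt-HodgeConjecture-24832`; HC_CM is proved only modulo the printed citations until rung 0 closes; nothing here is about HC.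

## References
* [MumfordAV1970] D. Mumford, *Abelian Varieties* (1970), §12 Thm. 1 (B) and its proof (pp. 111–115).
* [SGA1] A. Grothendieck, M. Raynaud, *SGA 1* (LNM 224), Exp. VIII §1 Thm. 1.1, Prop. 1.10.
* [StacksProject] The Stacks Project, Tag 023N (fpqc descent of quasi-coherent modules), Tag 01I7, Tag 01C8.
* [Hartshorne1977] R. Hartshorne, *Algebraic Geometry*, GTM 52 (1977), II §5 Cor. 5.5, Prop. 5.6 (p. 113).
-/

noncomputable section

-- `TopCat.Presheaf`/`Scheme.Modules` are not reducible (as in Mathlib's `AlgebraicGeometry/Modules` and the ★ twin).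
set_option backward.isDefEq.respectTransparency false

universe u

open CategoryTheory CategoryTheory.Limits AlgebraicGeometry MonoidalCategory CartesianMonoidalCategory TopologicalSpace Opposite
open Literature.AlgebraicGeometry.Modules Literature.AlgebraicGeometry.Motives
open scoped MonObj

namespace Literature.AlgebraicGeometry.RelativeSpec.SchemeEquivariant

variable {S : Scheme.{u}} {G X Q : Over S} [GrpObj G] [ModObj G X] (π : X ⟶ Q) (E : X.left.Modules)
  (hw : γ[G, X] ≫ π = snd G X ≫ π)
  (Φ : (Scheme.Modules.pullback (γ[G, X]).left).obj E ⟶ (Scheme.Modules.pullback (snd G X).left).obj E)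

/-! ### §0 The coinvariance condition in the INTERSECTION chart `γ⁻¹(π⁻¹V) ⊓ pr₂⁻¹(π⁻¹V)` (the kernel-pair chart of ★ `SectionsFpqcDescentChart`) -/

/-- Restriction of sections of a module along an inclusion of EQUAL opens is injective. [cite: Hartshorne1977, II §5 (p. 110)] -/
theorem presheaf_map_injective_of_eq {Y : Scheme.{u}} (N : Y.Modules) {W W' : Y.Opens} (h : W = W') (i : W ⟶ W') :
    Function.Injective (N.presheaf.map i.op) := by
  subst h
  intro a b hab
  rw [presheaf_map_congr N i (𝟙 _) a, presheaf_map_congr N i (𝟙 _) b] at hab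
  simpa using hab

/-- **COINVARIANT SECTIONS, INTERSECTION FORM** (the seam to the chart organ): `s ∈ Γ(π⁻¹V, E)` comes from the coinvariants iff `Φ(η_γ(s))` and `η_{pr₂}(s)` have the
SAME RESTRICTION to `W := γ⁻¹(π⁻¹V) ⊓ pr₂⁻¹(π⁻¹V)` — the form in which ★ `Morphisms/SectionsFpqcDescentChart` reads the two cofaces (no `eqToHom` transport; `W` equals
either open since `γ ≫ π = pr₂ ≫ π`). [cite: MumfordAV1970, §12 Theorem 1 (B) (p. 112)] [cite: SGA1, Exp. VIII Thm. 1.1] -/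
theorem mem_range_moduleCoinvariantsι_app_iff_inf (V : Q.left.Opens) (s : Γ(E, π.left ⁻¹ᵁ V)) :
    s ∈ Set.range ((moduleCoinvariantsι π E hw Φ).app V) ↔
      ((Scheme.Modules.pullback (snd G X).left).obj E).presheaf.map
          (homOfLE (inf_le_left : (γ[G, X]).left ⁻¹ᵁ (π.left ⁻¹ᵁ V) ⊓ (snd G X).left ⁻¹ᵁ (π.left ⁻¹ᵁ V) ≤ (γ[G, X]).left ⁻¹ᵁ (π.left ⁻¹ᵁ V))).op
          (Φ.app ((γ[G, X]).left ⁻¹ᵁ (π.left ⁻¹ᵁ V)) (unitSection (γ[G, X]).left E (π.left ⁻¹ᵁ V) s)) =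
        ((Scheme.Modules.pullback (snd G X).left).obj E).presheaf.map
          (homOfLE (inf_le_right : (γ[G, X]).left ⁻¹ᵁ (π.left ⁻¹ᵁ V) ⊓ (snd G X).left ⁻¹ᵁ (π.left ⁻¹ᵁ V) ≤ (snd G X).left ⁻¹ᵁ (π.left ⁻¹ᵁ V))).op
          (unitSection (snd G X).left E (π.left ⁻¹ᵁ V) s) := by
  rw [mem_range_moduleCoinvariantsι_app_iff]
  have hW : (γ[G, X]).left ⁻¹ᵁ (π.left ⁻¹ᵁ V) ⊓ (snd G X).left ⁻¹ᵁ (π.left ⁻¹ᵁ V) = (snd G X).left ⁻¹ᵁ (π.left ⁻¹ᵁ V) := by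
    rw [preimage_preimage_eq π hw V, inf_idem]
  have hinj := presheaf_map_injective_of_eq ((Scheme.Modules.pullback (snd G X).left).obj E) hW
    (homOfLE (inf_le_right : (γ[G, X]).left ⁻¹ᵁ (π.left ⁻¹ᵁ V) ⊓ (snd G X).left ⁻¹ᵁ (π.left ⁻¹ᵁ V) ≤ (snd G X).left ⁻¹ᵁ (π.left ⁻¹ᵁ V)))
  -- restricting the transported section to `W` = restricting the section itself to `W`
  have key : ∀ y : Γ((Scheme.Modules.pullback (snd G X).left).obj E, (γ[G, X]).left ⁻¹ᵁ (π.left ⁻¹ᵁ V)),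
      ((Scheme.Modules.pullback (snd G X).left).obj E).presheaf.map
          (homOfLE (inf_le_right : (γ[G, X]).left ⁻¹ᵁ (π.left ⁻¹ᵁ V) ⊓ (snd G X).left ⁻¹ᵁ (π.left ⁻¹ᵁ V) ≤ (snd G X).left ⁻¹ᵁ (π.left ⁻¹ᵁ V))).op
          (((Scheme.Modules.pullback (snd G X).left).obj E).presheaf.map (eqToHom (preimage_preimage_eq π hw V).symm).op y) =
        ((Scheme.Modules.pullback (snd G X).left).obj E).presheaf.map
          (homOfLE (inf_le_left : (γ[G, X]).left ⁻¹ᵁ (π.left ⁻¹ᵁ V) ⊓ (snd G X).left ⁻¹ᵁ (π.left ⁻¹ᵁ V) ≤ (γ[G, X]).left ⁻¹ᵁ (π.left ⁻¹ᵁ V))).op y :=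
    fun y => by
      rw [← CategoryTheory.comp_apply, ← Functor.map_comp]
      exact presheaf_map_congr _ _ _ _
  constructor
  · intro h
    rw [← h, key]
  · intro h
    apply hinj
    rw [key]
    exact h

/-! ### §1 The comparison is an isomorphism once it is one on the charts `π⁻¹V` -/

/-- **`π^*(π_*E)^G ⟶ E` IS AN ISOMORPHISM as soon as it is bijective on the sections over `π⁻¹V` for every affine open `V ⊆ Q`** (`π`, `pr₂` affine and
`E` quasi-coherent, so that both sides are quasi-coherent; ★ `isIso_of_app_bijective_of_cover` on the affine cover `{π⁻¹V}` of `X`). [cite: MumfordAV1970, §12 Theorem 1 (B) (p. 112)]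
[cite: Hartshorne1977, II Cor. 5.5 and Prop. 5.6 (p. 113)] -/
theorem isIso_descentHom_of_app_bijective [IsAffineHom π.left] [IsAffineHom (snd G X).left] (hE : IsAffineLocalizing E)
    (hbij : ∀ V : Q.left.Opens, IsAffineOpen V → Function.Bijective ((descentHom π E hw Φ).app (π.left ⁻¹ᵁ V))) :
    IsIso (descentHom π E hw Φ) := by
  refine isIso_of_app_bijective_of_cover (descentHom π E hw Φ)
    ((isAffineLocalizing_moduleCoinvariants π E hw Φ hE).pullback π.left) hE
    (fun V : Q.left.affineOpens => π.left ⁻¹ᵁ (V : Q.left.Opens)) (fun V => V.2.preimage π.left) ?_ (fun V => hbij V V.2)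
  rw [← Scheme.Hom.preimage_iSup, iSup_affineOpens_eq_top Q.left]
  rfl

/-! ### §2 The comparison carries the canonical linearisation of `π^*P` to `Φ` -/

/-- **Two maps out of a DOUBLE pull-back `f^*(g^*M)` that agree on all doubly pulled-back sections `η_f(η_g(x))` are equal** (★ `pullbackObj_hom_ext_unitSection` twice,
through the transposes along `f^* ⊣ f_*`; isolated as a lemma so that its consumer below elaborates against opaque `φ₁ φ₂` — buildfix N2 cure of the heartbeat cliff).
[cite: Hartshorne1977, II §5 (p. 110)] -/
theorem pullbackObj_pullbackObj_hom_ext_unitSection {X' Y' Z' : Scheme.{u}} (f : X' ⟶ Y') (g : Y' ⟶ Z') (M : Z'.Modules) {N : X'.Modules}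
    (φ₁ φ₂ : (Scheme.Modules.pullback f).obj ((Scheme.Modules.pullback g).obj M) ⟶ N)
    (h : ∀ (V : Z'.Opens) (x : Γ(M, V)),
      φ₁.app (f ⁻¹ᵁ (g ⁻¹ᵁ V)) (unitSection f ((Scheme.Modules.pullback g).obj M) (g ⁻¹ᵁ V) (unitSection g M V x)) =
        φ₂.app (f ⁻¹ᵁ (g ⁻¹ᵁ V)) (unitSection f ((Scheme.Modules.pullback g).obj M) (g ⁻¹ᵁ V) (unitSection g M V x))) :
    φ₁ = φ₂ := by
  apply Literature.AlgebraicGeometry.HodgeTheory.pullbackObj_hom_ext_unitSection f ((Scheme.Modules.pullback g).obj M)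
  intro W y
  revert W y
  -- compare the transposes `g^*M ⟶ f_*N`, which are determined on the sections `η_g(x)`
  suffices hθ : ((Scheme.Modules.pullbackPushforwardAdjunction f).homEquiv _ _) φ₁ =
      ((Scheme.Modules.pullbackPushforwardAdjunction f).homEquiv _ _) φ₂ by
    intro W y
    have h' := congrArg (fun ψ => (Scheme.Modules.Hom.app ψ W) y) hθ
    simp only [Adjunction.homEquiv_unit, Scheme.Modules.Hom.comp_app, CategoryTheory.comp_apply,
      Scheme.Modules.pushforward_map_app] at h'
    exact h'
  apply Literature.AlgebraicGeometry.HodgeTheory.pullbackObj_hom_ext_unitSection g M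
  intro V x
  simp only [Adjunction.homEquiv_unit, Scheme.Modules.Hom.comp_app, CategoryTheory.comp_apply, Scheme.Modules.pushforward_map_app]
  exact h V x

/-- **COMPATIBILITY WITH THE LINEARISATIONS** (hypothesis-free): with `P := (π_*E)^G` and `d := descentHom : π^*P ⟶ E`,
`γ^*(d) ≫ Φ = can ≫ pr₂^*(d)`, where `can : γ^*π^*P ≅ (γ ≫ π)^*P = (pr₂ ≫ π)^*P ≅ pr₂^*π^*P` is the canonical linearisation of a pull-back (Mathlib `pullbackComp`,
`pullbackCongr`) — i.e. `d` is a morphism of linearised modules.  Both sides are maps `γ^*(π^*P) ⟶ pr₂^*E`; they agree on the sections `η_γ(η_π(x))` (★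
`pullbackObj_hom_ext_unitSection`, twice), where the left side is `Φ(η_γ(ι x))` and the right side is `η_{pr₂}(ι x)` — equal because `ι x` is COINVARIANT (★
`moduleCoinvariantsι_app_invariant`). [cite: MumfordAV1970, §12 Theorem 1 (B) (p. 112)] [cite: SGA1, Exp. VIII Thm. 1.1] -/
theorem pullback_map_descentHom_comp :
    (Scheme.Modules.pullback (γ[G, X]).left).map (descentHom π E hw Φ) ≫ Φ =
      (((Scheme.Modules.pullbackComp (γ[G, X]).left π.left).app (moduleCoinvariants π E hw Φ) ≪≫
          (Scheme.Modules.pullbackCongr (smul_left_comp_eq π hw)).app (moduleCoinvariants π E hw Φ) ≪≫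
            ((Scheme.Modules.pullbackComp (snd G X).left π.left).app (moduleCoinvariants π E hw Φ)).symm).hom ≫
        (Scheme.Modules.pullback (snd G X).left).map (descentHom π E hw Φ)) := by
  -- both sides are morphisms `γ^*(π^*F) ⟶ pr₂^*E`: compare them on the sections `η_γ(η_π(x))`
  apply pullbackObj_pullbackObj_hom_ext_unitSection (γ[G, X]).left π.left (moduleCoinvariants π E hw Φ)
  intro V x
  simp only [Scheme.Modules.Hom.comp_app, CategoryTheory.comp_apply, Iso.trans_hom, Iso.app_hom, Iso.symm_hom, Iso.app_inv]
  -- now both sides are evaluated at `η_γ(η_π(x))`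
  change Φ.app _ (((Scheme.Modules.pullback (γ[G, X]).left).map (descentHom π E hw Φ)).app _
      (unitSection (γ[G, X]).left _ (π.left ⁻¹ᵁ V) (unitSection π.left (moduleCoinvariants π E hw Φ) V x))) =
    ((Scheme.Modules.pullback (snd G X).left).map (descentHom π E hw Φ)).app _
      (((Scheme.Modules.pullbackComp (snd G X).left π.left).inv.app (moduleCoinvariants π E hw Φ)).app _
        (((Scheme.Modules.pullbackCongr (smul_left_comp_eq π hw)).hom.app (moduleCoinvariants π E hw Φ)).app _
          (((Scheme.Modules.pullbackComp (γ[G, X]).left π.left).hom.app (moduleCoinvariants π E hw Φ)).app _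
            (unitSection (γ[G, X]).left _ (π.left ⁻¹ᵁ V) (unitSection π.left (moduleCoinvariants π E hw Φ) V x)))))
  -- left: `Φ(η_γ(ι x))`
  rw [pullback_map_app_unitSection, descentHom_app_unitSection]
  -- right: `η_γ(η_π x) ↦ η_{γ ≫ π}(x) ↦ (transport of) η_{pr₂ ≫ π}(x) ↦ η_{pr₂}(η_π x) ↦ η_{pr₂}(ι x)`
  rw [pullbackComp_hom_app_unitSection]
  have hcg : ((Scheme.Modules.pullbackCongr (smul_left_comp_eq π hw)).hom.app (moduleCoinvariants π E hw Φ)).app ((γ[G, X]).left ⁻¹ᵁ (π.left ⁻¹ᵁ V))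
        (unitSection ((γ[G, X]).left ≫ π.left) (moduleCoinvariants π E hw Φ) V x) =
      ((Scheme.Modules.pullback ((snd G X).left ≫ π.left)).obj (moduleCoinvariants π E hw Φ)).presheaf.map
        (eqToHom (preimage_preimage_eq π hw V)).op (unitSection ((snd G X).left ≫ π.left) (moduleCoinvariants π E hw Φ) V x) :=
    pullbackCongr_hom_app_unitSection (moduleCoinvariants π E hw Φ) (smul_left_comp_eq π hw) V x
  rw [hcg, app_presheaf_map, pullbackComp_inv_app_unitSection]
  erw [app_presheaf_map]
  rw [pullback_map_app_unitSection, descentHom_app_unitSection]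
  -- the coinvariance of `ι x`
  have hinv := moduleCoinvariantsι_app_invariant π E hw Φ V x
  have hinj : Function.Injective (((Scheme.Modules.pullback (snd G X).left).obj E).presheaf.map
      (eqToHom (preimage_preimage_eq π hw V).symm).op) :=
    (((Scheme.Modules.pullback (snd G X).left).obj E).presheaf.mapIso
      (eqToIso (preimage_preimage_eq π hw V).symm).op).addCommGroupIsoToAddEquiv.injective
  apply hinj
  rw [hinv]
  exact ((presheaf_map_map_congr _ _ _ (𝟙 _) _).trans (presheaf_map_self _ _ _)).symm

/-! ### §3 The descended module has the rank of `E` -/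

/-- **RANK DESCENDS**: if `E` has rank `r`, `π` is surjective and the sections of `(π_*E)^G` over every affine `V ⊆ Q` form a finite projective
`Γ(V, 𝒪_Q)`-module, and the comparison is chartwise bijective, then `(π_*E)^G` has rank `r` — at every point of `Q` a frame of `(π_*E)^G` on a basic open of an affine
neighbourhood (★ `exists_free_over_basicOpen_of_projective_sections`), whose size is read off after pulling back to `E` through a point of `X` above (★
`card_eq_of_free_iso_over_of_hasRank_pullback`), assembled by ★ `FrameSystem.hasRank` — the road of ★ `ActionOver.hasRank_moduleInvariants_of_free`.
[cite: SGA1, Exp. VIII Prop. 1.10] [cite: MumfordAV1970, §12 Theorem 1 (B) (p. 112)] [cite: StacksProject, Tag 01C8] -/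
theorem hasRank_moduleCoinvariants_of_projective_sections [IsAffineHom π.left] [IsAffineHom (snd G X).left] [Surjective π.left]
    (hbij : ∀ V : Q.left.Opens, IsAffineOpen V → Function.Bijective ((descentHom π E hw Φ).app (π.left ⁻¹ᵁ V)))
    (hproj : ∀ V : Q.left.Opens, IsAffineOpen V →
      Module.Finite Γ(Q.left, V) Γ(moduleCoinvariants π E hw Φ, V) ∧ Module.Projective Γ(Q.left, V) Γ(moduleCoinvariants π E hw Φ, V))
    {r : ℕ} (hE : HasRank E r) : HasRank (moduleCoinvariants π E hw Φ) r := by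
  classical
  set F := moduleCoinvariants π E hw Φ with hF
  have hEal : IsAffineLocalizing E :=
    haveI := (HasRank.isFiniteLocallyFree' hE).isVectorBundle.1
    IsAffineLocalizing.of_isQuasicoherent E
  have hFal : IsAffineLocalizing F := isAffineLocalizing_moduleCoinvariants π E hw Φ hEal
  haveI := isIso_descentHom_of_app_bijective π E hw Φ hEal hbij
  let eF : (Scheme.Modules.pullback π.left).obj F ≅ E := asIso (descentHom π E hw Φ)
  -- at every point: a frame of size `r` on a basic open of an affine neighbourhood
  have key : ∀ q : ↥Q.left, ∃ (U : Q.left.Opens) (I : Type u) (_ : SheafOfModules.free I ≅ F.over U), q ∈ U ∧ ∃ _ : Finite I, Nat.card I = r := by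
    intro q
    obtain ⟨V, hV, hqV, -⟩ := exists_isAffineOpen_mem_and_subset (U := ⊤) (Opens.mem_top q)
    obtain ⟨hFfin, hFproj⟩ := hproj V hV
    obtain ⟨s, hqs, I, hI, ⟨e⟩⟩ := exists_free_over_basicOpen_of_projective_sections hFal hV hqV
    obtain ⟨x, hx⟩ := π.left.surjective q
    have hxU : π.left.base x ∈ Q.left.basicOpen s := by rw [hx]; exact hqs
    exact ⟨Q.left.basicOpen s, I, e, hqs, hI, card_eq_of_free_iso_over_of_hasRank_pullback π.left eF hE e hxU⟩
  choose U I e hqU hI hcard using key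
  exact FrameSystem.hasRank
    { U := U
      mem := hqU
      I := I
      rank := fun _ => r
      enum := fun q => Finite.equivFinOfCardEq (hcard q)
      frame := e } r fun _ => rfl

/-! ### §4 The descended module: existence statements -/

/-- **DESCENT ALONG A TORSOR QUOTIENT — EXISTENCE (quasi-coherent form).**  `π`, `pr₂` affine, `E` quasi-coherent with a linearisation morphism `Φ`, and the comparison
chartwise bijective: `E ≅ π^*P` for the quasi-coherent `P := (π_*E)^G` on `Q`, COMPATIBLY with the linearisations (§2). [cite: MumfordAV1970, §12 Theorem 1 (B) (p. 112)]
[cite: SGA1, Exp. VIII Thm. 1.1] -/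
theorem exists_descent_of_app_bijective [IsAffineHom π.left] [IsAffineHom (snd G X).left] [E.IsQuasicoherent]
    (hbij : ∀ V : Q.left.Opens, IsAffineOpen V → Function.Bijective ((descentHom π E hw Φ).app (π.left ⁻¹ᵁ V))) :
    ∃ (P : Q.left.Modules) (_ : P.IsQuasicoherent) (e : (Scheme.Modules.pullback π.left).obj P ≅ E),
      (Scheme.Modules.pullback (γ[G, X]).left).map e.hom ≫ Φ =
        (((Scheme.Modules.pullbackComp (γ[G, X]).left π.left).app P ≪≫ (Scheme.Modules.pullbackCongr (smul_left_comp_eq π hw)).app P ≪≫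
            ((Scheme.Modules.pullbackComp (snd G X).left π.left).app P).symm).hom ≫ (Scheme.Modules.pullback (snd G X).left).map e.hom) := by
  have hE : IsAffineLocalizing E := IsAffineLocalizing.of_isQuasicoherent E
  haveI := isIso_descentHom_of_app_bijective π E hw Φ hE hbij
  exact ⟨moduleCoinvariants π E hw Φ, isQuasicoherent_of_isAffineLocalizing (isAffineLocalizing_moduleCoinvariants π E hw Φ hE),
    asIso (descentHom π E hw Φ), pullback_map_descentHom_comp π E hw Φ⟩

/-- **DESCENT ALONG A TORSOR QUOTIENT — EXISTENCE WITH RANK** (the shape the §D junction binds, `r := 1`): `E` of rank `r` with a linearisation morphism `Φ`, `π`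
surjective with `π`, `pr₂` affine, the comparison chartwise bijective and the coinvariant sections chartwise finite projective ⟹ `∃ P` of rank `r` with `π^*P ≅ E`.
[cite: SGA1, Exp. VIII Prop. 1.10] [cite: MumfordAV1970, §12 Theorem 1 (B) (p. 112)] -/
theorem exists_descent_of_hasRank [IsAffineHom π.left] [IsAffineHom (snd G X).left] [Surjective π.left]
    (hbij : ∀ V : Q.left.Opens, IsAffineOpen V → Function.Bijective ((descentHom π E hw Φ).app (π.left ⁻¹ᵁ V)))
    (hproj : ∀ V : Q.left.Opens, IsAffineOpen V →
      Module.Finite Γ(Q.left, V) Γ(moduleCoinvariants π E hw Φ, V) ∧ Module.Projective Γ(Q.left, V) Γ(moduleCoinvariants π E hw Φ, V))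
    {r : ℕ} (hE : HasRank E r) :
    ∃ P : Q.left.Modules, HasRank P r ∧ Nonempty ((Scheme.Modules.pullback π.left).obj P ≅ E) := by
  have hEal : IsAffineLocalizing E :=
    haveI := (HasRank.isFiniteLocallyFree' hE).isVectorBundle.1
    IsAffineLocalizing.of_isQuasicoherent E
  haveI := isIso_descentHom_of_app_bijective π E hw Φ hEal hbij
  exact ⟨moduleCoinvariants π E hw Φ, hasRank_moduleCoinvariants_of_projective_sections π E hw Φ hbij hproj hE, ⟨asIso (descentHom π E hw Φ)⟩⟩


/-! ### §5 The CHART STEP: chartwise bijectivity of the comparison from a base-change identification of the coinvariant sections -/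

/-- **THE CHART STEP** (discharges `hbij V`): if, in the chart dress of ★ `isBaseChange_unitSectionLE` (`Γ(V) → Γ(π⁻¹V)` via `π.appLE`, `Γ(π⁻¹V, E)` a `Γ(V)`-module
through it), a `Γ(V)`-linear `j : Γ(V, (π_*E)^G) → Γ(π⁻¹V, E)` that IS the inclusion `ι` pointwise exhibits `Γ(π⁻¹V, E)` as the BASE CHANGE `Γ(π⁻¹V) ⊗_{Γ(V)} Γ(V, (π_*E)^G)`
(the chart organ's conclusion: faithfully flat descent ★ `ModuleDescent.liftBaseChange_bijective` read through the torsor square), then the comparison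
`π^*(π_*E)^G ⟶ E` is BIJECTIVE on `π⁻¹V`-sections — because `Γ(π⁻¹V, π^*𝓟) = Γ(π⁻¹V) ⊗_{Γ(V)} Γ(V, 𝓟)` too (★ `isBaseChange_unitSectionLE`) and the comparison
is `η(y) ↦ ι(y)` (★ `descentHom_app_unitSection`). [cite: MumfordAV1970, §12 Theorem 1 (B) (p. 112)] [cite: SGA1, Exp. VIII Thm. 1.1] -/
theorem descentHom_app_bijective_of_isBaseChange [IsAffineHom π.left] [IsAffineHom (snd G X).left] (hE : IsAffineLocalizing E)
    {V : Q.left.Opens} (hV : IsAffineOpen V)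
    (j : letI : Module Γ(Q.left, V) Γ(E, π.left ⁻¹ᵁ V) := Module.compHom _ (π.left.appLE V (π.left ⁻¹ᵁ V) le_rfl).hom
      Γ(moduleCoinvariants π E hw Φ, V) →ₗ[Γ(Q.left, V)] Γ(E, π.left ⁻¹ᵁ V))
    (hjι : ∀ y, j y = (moduleCoinvariantsι π E hw Φ).app V y)
    (hbc : letI := (π.left.appLE V (π.left ⁻¹ᵁ V) le_rfl).hom.toAlgebra
      letI : Module Γ(Q.left, V) Γ(E, π.left ⁻¹ᵁ V) := Module.compHom _ (π.left.appLE V (π.left ⁻¹ᵁ V) le_rfl).hom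
      haveI : IsScalarTower Γ(Q.left, V) Γ(X.left, π.left ⁻¹ᵁ V) Γ(E, π.left ⁻¹ᵁ V) :=
        ⟨fun a b x => mul_smul ((π.left.appLE V (π.left ⁻¹ᵁ V) le_rfl).hom a) b x⟩
      IsBaseChange Γ(X.left, π.left ⁻¹ᵁ V) j) :
    Function.Bijective ((descentHom π E hw Φ).app (π.left ⁻¹ᵁ V)) := by
  letI := (π.left.appLE V (π.left ⁻¹ᵁ V) le_rfl).hom.toAlgebra
  letI : Module Γ(Q.left, V) Γ(E, π.left ⁻¹ᵁ V) := Module.compHom _ (π.left.appLE V (π.left ⁻¹ᵁ V) le_rfl).hom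
  haveI : IsScalarTower Γ(Q.left, V) Γ(X.left, π.left ⁻¹ᵁ V) Γ(E, π.left ⁻¹ᵁ V) :=
    ⟨fun a b x => mul_smul ((π.left.appLE V (π.left ⁻¹ᵁ V) le_rfl).hom a) b x⟩
  letI : Module Γ(Q.left, V) Γ((Scheme.Modules.pullback π.left).obj (moduleCoinvariants π E hw Φ), π.left ⁻¹ᵁ V) :=
    Module.compHom _ (π.left.appLE V (π.left ⁻¹ᵁ V) le_rfl).hom
  haveI : IsScalarTower Γ(Q.left, V) Γ(X.left, π.left ⁻¹ᵁ V) Γ((Scheme.Modules.pullback π.left).obj (moduleCoinvariants π E hw Φ), π.left ⁻¹ᵁ V) :=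
    ⟨fun a b x => mul_smul ((π.left.appLE V (π.left ⁻¹ᵁ V) le_rfl).hom a) b x⟩
  have hU : IsAffineOpen (π.left ⁻¹ᵁ V) := hV.preimage π.left
  have hPal : IsAffineLocalizing (moduleCoinvariants π E hw Φ) := isAffineLocalizing_moduleCoinvariants π E hw Φ hE
  -- `Γ(π⁻¹V, π^*𝓟)` is the base change of `Γ(V, 𝓟)` (★)
  have hbc₁ := isBaseChange_unitSectionLE π.left (moduleCoinvariants π E hw Φ) (le_rfl : π.left ⁻¹ᵁ V ≤ π.left ⁻¹ᵁ V) hV hU hPal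
  -- the comparison on sections, through the two base-change identifications, is the identity of `Γ(π⁻¹V) ⊗ Γ(V, 𝓟)`
  have key : ∀ t, (descentHom π E hw Φ).app (π.left ⁻¹ᵁ V) (hbc₁.equiv t) = hbc.equiv t := by
    intro t
    induction t using TensorProduct.induction_on with
    | zero => rw [map_zero, map_zero, map_zero]
    | tmul s y =>
      rw [IsBaseChange.equiv_tmul, IsBaseChange.equiv_tmul, Scheme.Modules.Hom.app_smul, unitSectionLEₗ_apply, hjι,
        unitSectionLE, presheaf_map_self, descentHom_app_unitSection]
    | add a b ha hb => rw [map_add, map_add, map_add, ha, hb]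
  have hfun : ⇑((descentHom π E hw Φ).app (π.left ⁻¹ᵁ V)) = hbc.equiv ∘ hbc₁.equiv.symm := by
    funext z
    have h := key (hbc₁.equiv.symm z)
    rw [LinearEquiv.apply_symm_apply] at h
    exact h
  rw [hfun]
  exact hbc.equiv.bijective.comp hbc₁.equiv.symm.bijective

end Literature.AlgebraicGeometry.RelativeSpec.SchemeEquivariant

end
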